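import Summits.Ventures.PercRepro.RankLevelSetExplicitLin2KeyCube

/-!
# PercRepro — THE LEVEL-13 CUBE ROW OF C-025: THE KEY AT `p = 29 385` AND THE CONDITIONAL LEVEL STEP (p9, S4)

`proofs/SUBCLAIM-S4-p9.md` §S4.2⁗‴. The saturated row of record at level `13` is `p ≥ 85 609` (RankLevelSetExplicitLin2RowThirteen).
With p4's cube multiplicity the assembled inequality `(P_d)` holds, exactly evaluated, at EVERY core corank `14 ≤ d ≤ 8205`
from `p = 29 385` — and fails at `p = 29 384` (corank `5 106`, the big class's saturation corank):
the cube key `KeyC 13 29385 d` (RankLevelSetExplicitLin2KeyCube) is checked by the kernel at the 8 192 coranks (`decide`, 2 chunks of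
4 096), and `c025_level_succ_of_keyC_row` turns the row into the level step
**`c025_thirteen_cube_step (hprev : ∀ M p, 29 384 ≤ p → RLS M p 12) : ∀ M p, 29 385 ≤ p → RLS M p 13`** (`N₁(13) = 16 778`,
tail `16 454`). The unconditional rows are composed in RankLevelSetExplicitLin2CubeFloor. Axioms: standard.
-/

open scoped Matroid

namespace PercRepro

namespace ThmN

namespace Explicit

/-- The cube key row at `(q, p) = (13, 29 385)`, chunk 1 of 2: coranks `14 … 4109`, by the kernel. -/
theorem key_thirteen_cube_row_1 : ∀ t < 4096, KeyC 13 29385 (14 + t) := by decide +kernel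

/-- The cube key row at `(q, p) = (13, 29 385)`, chunk 2 of 2: coranks `4110 … 8205`, by the kernel. -/
theorem key_thirteen_cube_row_2 : ∀ t < 4096, KeyC 13 29385 (14 + (4096 + t)) := by decide +kernel

/-- **THE CUBE KEY ROW AT `(q, p) = (13, 29 385)`**: `KeyC 13 29385 d` at every corank `14 ≤ d ≤ 8205` (the 2 chunks). -/
theorem key_thirteen_cube_row : ∀ t < 8192, KeyC 13 29385 (14 + t) :=
  ball_lt_add (fun t => KeyC 13 29385 (14 + t)) 4096 4096
    (key_thirteen_cube_row_1) key_thirteen_cube_row_2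

/-- **THE CUBE FLOOR IS EXACT**: the cube key FAILS at `p = 29 384`, corank `5 106` (the big class's saturation corank), by the kernel. -/
theorem key_thirteen_cube_sharp : ¬ KeyC 13 29384 5106 := by decide +kernel

end Explicit

variable {α : Type}

/-- **THE LEVEL-13 CUBE STEP FROM `29 385`**: level `13` for every finite matroid and every `p ≥ 29 385` from level `12` for
every `p ≥ 29 384` — the cube key row at `29 385`, its monotonicity in `p`, and the wrapper `c025_level_succ_of_keyC_row`
(`N₁(13) = 16 778 ≤ 29 385`, tail `16 454 ≤ 29 385`). -/
theorem c025_thirteen_cube_step (hprev : ∀ (M : Matroid α) [M.Finite] (p : ℕ), 29384 ≤ p → RLS M p 12) :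
    ∀ (M : Matroid α) [M.Finite] (p : ℕ), 29385 ≤ p → RLS M p 13 :=
  c025_level_succ_of_keyC_row 12 (by norm_num) 29385 (by norm_num) (by norm_num) Explicit.key_thirteen_cube_row hprev

end ThmN

end PercRepro
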